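import Literature.NumberTheory.Automorphic.GLnPlacesSplitting
import Literature.NumberTheory.Automorphic.AdeleAwayFromPlaces
import Literature.Topology.Algebra.IdempotentUnitsQuotient
import HarnessLib

/-!
# `G^S ≅ GL_n(𝔸_K^S)`: the elements of `GL_n(𝔸_K)` trivial at the places of `S` form `GL_n` of the
# adeles away from `S`
(Gelbart, *Automorphic forms on adele groups* (1975), §10, p. 153: "`G^S = {g ∈ G_𝔸 : g_v = 1, v ∈ S}`";
Bump (1997), §3.3)

Topic `NumberTheory/Automorphic`; definitions with bodies (`GLn.placesIdem`, `GLn.awayProj`,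
`GLn.awaySection`, `GLn.cornerUnitsEquivAwayGL`, `GLn.trivialAtEquivAwayGL`) and theorems; no named
fact, no instance. The `GL_n` twin of `QuaternionAdelicUnitsAwayFromPlaces`.

With `E_S = e_S · 1_n ∈ M_n(𝔸_K)` (central idempotent; `e_S = adelePlacesIdem K S`), the tree's subgroup
`GLn.trivialAt n K S = G^S` (`GLnPlacesSplitting`) is the corner unit group
`Literature.Topology.Algebra.cornerUnits (1 - E_S)` (`GLn.trivialAt_eq_cornerUnits`: `g_v = 1` for
`v ∈ S` iff `e_S g = e_S 1`, entrywise `adelePlacesIdem_mul_eq_mul_iff`), and the entrywise projection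
`q : M_n(𝔸_K) → M_n(𝔸_K^S)` (`GLn.awayProj`, `𝔸_K^S = AdeleAway K S = 𝔸_K ⧸ (e_S)`) with the entrywise
section `σ` (`GLn.awaySection`, `x̄ ↦ (1 - e_S) x`) satisfy `q ∘ σ = id`, `σ ∘ q = ((1 - E_S) ·)`, both
continuous; hence (`cornerUnitsContinuousEquivOfSection`, `IdempotentUnitsQuotient`)

* `GLn.trivialAtEquivAwayGL n K S : GLn.trivialAt n K S ≃ₜ* GL (Fin n) (AdeleAway K S)` — **`G^S` is
  `GL_n(𝔸_K^S)` as a topological group** — and `GLn.units_map_awayProj_surjective`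
  (`GL_n(𝔸_K) → GL_n(𝔸_K^S)` is onto).

Part of the inline (D-0026) decomposition of
`Literature.NumberTheory.Automorphic.strong_multiplicity_one_quaternionUnits` (Gelbart's `G'^S = G^S`).

## References

* S. Gelbart, *Automorphic forms on adele groups*, Ann. of Math. Studies 83 (1975), §10, p. 153
  [Gelbart1975].
* D. Bump, *Automorphic Forms and Representations* (1997), §3.3 [Bump1997].
-/

noncomputable section

open NumberField IsDedekindDomain Topology
open Literature.Topology.Algebra

namespace Literature.NumberTheory.Automorphic

section Away

variable (n : ℕ) (K : Type) [Field K] [NumberField K] (S : Finset (HeightOneSpectrum (𝓞 K)))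

/-- **The idempotent `E_S = e_S · 1_n ∈ M_n(𝔸_K)`** of the places of `S`. [folklore] -/
def GLn.placesIdem : Matrix (Fin n) (Fin n) (AdeleRing (𝓞 K) K) :=
  algebraMap (AdeleRing (𝓞 K) K) _ (adelePlacesIdem K S)

/-- `E_S` is an idempotent. [folklore] -/
theorem GLn.isIdempotentElem_placesIdem : IsIdempotentElem (GLn.placesIdem n K S) := by
  rw [IsIdempotentElem, GLn.placesIdem, ← map_mul, (isIdempotentElem_adelePlacesIdem S).eq]

/-- `E_S` is central. [folklore] -/
theorem GLn.placesIdem_mem_center :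
    GLn.placesIdem n K S ∈ Subring.center (Matrix (Fin n) (Fin n) (AdeleRing (𝓞 K) K)) :=
  Subring.mem_center_iff.2 fun X => (Algebra.commutes _ X).symm

/-- `E_S M = e_S • M` has entries `e_S M_{ij}`. [folklore] -/
theorem GLn.placesIdem_mul_apply (M : Matrix (Fin n) (Fin n) (AdeleRing (𝓞 K) K)) (i j : Fin n) :
    (GLn.placesIdem n K S * M) i j = adelePlacesIdem K S * M i j := by
  rw [GLn.placesIdem, ← Algebra.smul_def, Matrix.smul_apply, smul_eq_mul]

/-- The entries of `E_S`: `e_S` on the diagonal. [folklore] -/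
theorem GLn.placesIdem_apply (i j : Fin n) :
    GLn.placesIdem n K S i j = adelePlacesIdem K S * (1 : Matrix (Fin n) (Fin n) (AdeleRing (𝓞 K) K)) i j := by
  rw [GLn.placesIdem, Algebra.algebraMap_eq_smul_one, Matrix.smul_apply, smul_eq_mul]

variable {n K S} in
/-- `g_v = 1` iff the `v`-components of the entries of `g` are those of `1`. [folklore] -/
theorem GLn.toLocalAt_eq_one_iff (v : HeightOneSpectrum (𝓞 K)) (g : (AdelicGroupData.gl n K).Adelic) :
    GLn.toLocalAt n K v g = 1 ↔ ∀ i j : Fin n,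
      AdelicGroupData.adeleEval K v (Units.val g i j) =
        AdelicGroupData.adeleEval K v ((1 : Matrix (Fin n) (Fin n) (AdeleRing (𝓞 K) K)) i j) := by
  constructor
  · intro h i j
    have h1 := congrArg (fun x : GL (Fin n) (v.adicCompletion K) => (x : Matrix (Fin n) (Fin n) (v.adicCompletion K)) i j) h
    rw [adeleEval_one_apply]
    exact h1
  · intro h
    refine Matrix.GeneralLinearGroup.ext fun i j => ?_
    rw [Units.val_one, ← adeleEval_one_apply n K v i j]
    exact h i j

variable {n K S} in
/-- **`G^S = U_{1-E_S}`**: `g ∈ GL_n(𝔸_K)` is trivial at the places of `S` iff `E_S g = E_S`, i.e. iff it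
lies in the corner unit group of `1 - E_S` (of `M_n(𝔸_K)ˣ = GL_n(𝔸_K)`). [folklore] -/
theorem GLn.mem_trivialAt_iff_mem_cornerUnits {g : (AdelicGroupData.gl n K).Adelic} :
    g ∈ GLn.trivialAt n K S ↔
      g ∈ (cornerUnits (1 - GLn.placesIdem n K S) : Subgroup (AdelicGroupData.gl n K).Adelic) := by
  rw [GLn.mem_trivialAt_iff]
  change _ ↔ (1 - (1 - GLn.placesIdem n K S)) * Units.val g = 1 - (1 - GLn.placesIdem n K S)
  rw [sub_sub_cancel]
  constructor
  · intro h
    ext i j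
    rw [GLn.placesIdem_mul_apply, GLn.placesIdem_apply, adelePlacesIdem_mul_eq_mul_iff]
    exact fun v hv => (GLn.toLocalAt_eq_one_iff v g).1 (h v hv) i j
  · intro h v hv
    refine (GLn.toLocalAt_eq_one_iff v g).2 fun i j => ?_
    have h1 : (GLn.placesIdem n K S * Units.val g) i j = GLn.placesIdem n K S i j := by rw [h]
    rw [GLn.placesIdem_mul_apply, GLn.placesIdem_apply, adelePlacesIdem_mul_eq_mul_iff] at h1
    exact h1 v hv

variable {n K S} in
/-- The same as an equality of subgroups. [folklore] -/
theorem GLn.trivialAt_eq_cornerUnits :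
    GLn.trivialAt n K S = (cornerUnits (1 - GLn.placesIdem n K S) : Subgroup (AdelicGroupData.gl n K).Adelic) :=
  Subgroup.ext fun _ => GLn.mem_trivialAt_iff_mem_cornerUnits

/-- **The entrywise projection `q : M_n(𝔸_K) →+* M_n(𝔸_K^S)`.** [folklore] -/
def GLn.awayProj : Matrix (Fin n) (Fin n) (AdeleRing (𝓞 K) K) →+* Matrix (Fin n) (Fin n) (AdeleAway K S) :=
  (AdeleAway.mk K S).toRingHom.mapMatrix

/-- **The entrywise section `σ : M_n(𝔸_K^S) → M_n(𝔸_K)`**, `x̄ ↦ (1 - e_S) x` entrywise. [folklore] -/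
def GLn.awaySection (M : Matrix (Fin n) (Fin n) (AdeleAway K S)) : Matrix (Fin n) (Fin n) (AdeleRing (𝓞 K) K) :=
  M.map (AdeleAway.lift K S)

variable {n K S}

/-- `q M = M.map mk` (definitional). [folklore] -/
theorem GLn.awayProj_apply (M : Matrix (Fin n) (Fin n) (AdeleRing (𝓞 K) K)) :
    GLn.awayProj n K S M = M.map (AdeleAway.mk K S) := rfl

/-- `q (σ M) = M`. [folklore] -/
theorem GLn.awayProj_awaySection (M : Matrix (Fin n) (Fin n) (AdeleAway K S)) :
    GLn.awayProj n K S (GLn.awaySection n K S M) = M := by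
  ext i j
  rw [GLn.awayProj_apply, GLn.awaySection, Matrix.map_apply, Matrix.map_apply, AdeleAway.mk_lift]

/-- `σ (q M) = (1 - E_S) M`. [folklore] -/
theorem GLn.awaySection_awayProj (M : Matrix (Fin n) (Fin n) (AdeleRing (𝓞 K) K)) :
    GLn.awaySection n K S (GLn.awayProj n K S M) = (1 - GLn.placesIdem n K S) * M := by
  ext i j
  rw [sub_mul, one_mul, Matrix.sub_apply, GLn.placesIdem_mul_apply, GLn.awaySection, GLn.awayProj_apply, Matrix.map_apply,
    Matrix.map_apply, AdeleAway.lift_mk, sub_mul, one_mul]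

variable (n K S)

/-- `q` is continuous. [folklore] -/
theorem GLn.continuous_awayProj : Continuous (GLn.awayProj n K S) :=
  continuous_id.matrix_map (AdeleAway.continuous_mk K S)

/-- `σ` is continuous. [folklore] -/
theorem GLn.continuous_awaySection : Continuous (GLn.awaySection n K S) :=
  continuous_id.matrix_map (AdeleAway.continuous_lift K S)

/-- **`U_{1-E_S} ≃ₜ* GL_n(𝔸_K^S)`**: `cornerUnitsContinuousEquivOfSection` for the entrywise `q`, `σ`.
[folklore] -/
def GLn.cornerUnitsEquivAwayGL : cornerUnits (1 - GLn.placesIdem n K S) ≃ₜ* GL (Fin n) (AdeleAway K S) :=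
  cornerUnitsContinuousEquivOfSection (GLn.isIdempotentElem_placesIdem n K S) (GLn.placesIdem_mem_center n K S)
    (GLn.awayProj n K S) (GLn.awaySection n K S)
    (fun M => GLn.awayProj_awaySection M) (fun M => GLn.awaySection_awayProj M)
    (GLn.continuous_awayProj n K S) (GLn.continuous_awaySection n K S)

/-- **`G^S ≃ₜ* GL_n(𝔸_K^S)`** (Gelbart's `G^S`): the elements of `GL_n(𝔸_K)` trivial at the places of
`S` form `GL_n` of the adeles away from `S`, as topological groups; the isomorphism is entrywise
reduction mod `e_S`, its inverse `u ↦ E_S + (1 - E_S) σ(u)`. [cite: Gelbart1975, §10 p. 153] -/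
def GLn.trivialAtEquivAwayGL : GLn.trivialAt n K S ≃ₜ* GL (Fin n) (AdeleAway K S) :=
  (continuousMulEquivOfSubgroupEq GLn.trivialAt_eq_cornerUnits).trans (GLn.cornerUnitsEquivAwayGL n K S)

variable {n K S} in
/-- The isomorphism is entrywise reduction on underlying matrices. [folklore] -/
theorem GLn.coe_trivialAtEquivAwayGL (g : GLn.trivialAt n K S) :
    ((GLn.trivialAtEquivAwayGL n K S g : GL (Fin n) (AdeleAway K S)) : Matrix (Fin n) (Fin n) (AdeleAway K S)) =
      (Units.val (show GL (Fin n) (AdeleRing (𝓞 K) K) from (g : (AdelicGroupData.gl n K).Adelic))).map (AdeleAway.mk K S) := rfl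

variable {n K S} in
/-- The inverse is `u ↦ E_S + (1 - E_S) σ(u)` on underlying matrices. [folklore] -/
theorem GLn.coe_trivialAtEquivAwayGL_symm (u : GL (Fin n) (AdeleAway K S)) :
    Units.val (show GL (Fin n) (AdeleRing (𝓞 K) K) from
        (((GLn.trivialAtEquivAwayGL n K S).symm u : GLn.trivialAt n K S) : (AdelicGroupData.gl n K).Adelic)) =
      GLn.placesIdem n K S + (1 - GLn.placesIdem n K S) *
        (u : Matrix (Fin n) (Fin n) (AdeleAway K S)).map (AdeleAway.lift K S) := rfl

/-- **`GL_n(𝔸_K) → GL_n(𝔸_K^S)` is onto.** [folklore] -/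
theorem GLn.units_map_awayProj_surjective :
    Function.Surjective (Units.map (GLn.awayProj n K S : Matrix (Fin n) (Fin n) (AdeleRing (𝓞 K) K) →*
      Matrix (Fin n) (Fin n) (AdeleAway K S))) :=
  units_map_surjective (GLn.isIdempotentElem_placesIdem n K S) (GLn.placesIdem_mem_center n K S)
    (GLn.awayProj n K S) (GLn.awaySection n K S)
    (fun M => GLn.awayProj_awaySection M) (fun M => GLn.awaySection_awayProj M)

end Away

end Literature.NumberTheory.Automorphic
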